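import Mathlib
import Summits.KontsevichZagierPeriods.Zeta5Search.WedgeDictionaryIntegralPartPQ
import Summits.KontsevichZagierPeriods.Zeta5Search.WedgeDictionarySumRuleDatum
import Summits.KontsevichZagierPeriods.Zeta5Search.WedgeDictionaryDiagonalDecomposition
import Summits.KontsevichZagierPeriods.Zeta5Search.WedgeDictionaryOneTopIntegral
import Summits.KontsevichZagierPeriods.Zeta5Search.CellularZetaFiveZeroIntegral
import HarnessLib

/-!
# The wedge dictionary holds; Brown–Zudilin's Sect. 2 (`I_init`, `I_solvesRec`) are theorems
# (cell `pub-zeta5`, seat ct-1 g21 — the closing file of the D2 dictionary programme)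

HONEST FRAMING: systematic search; no irrationality claim unless certified.  Modus ponens only: the two exact evaluations
`WedgeDictionaryOneTopIntegral.cellularIntegral_oneTop` (`I(1,0,1,0,1,1,0,1) = 2ζ(5) + 4ζ(2)ζ(3) − 5ζ(2) − 3/2`) and
`CellularZetaFiveZeroIntegral.Isym_zero` (`I₀ = 2ζ(5) + 4ζ(3)ζ(2)`) fed into ct-1 g18–g20's equivalences
(`WedgeDictionarySumRuleDatum.explicitPQ_iff_oneTop`, `WedgeDictionaryIntegralPartPQ.wedgeDictionary_iff_explicitPQ`,
`WedgeDictionaryDiagonalDecomposition.I_init_iff`, `I_solvesRec_of_I_init`):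

* `explicitPQ_holds` — gen-1's explicit `(P̂, P)` form of the dictionary at EVERY admissible `a` and partner;
* `wedgeDictionary_holds` — the cell's internally minted `@[conjecture] wedgeDictionary`;
* `I_init_holds` — the Literature named fact `BrownZudilin2022.I_init` (Sect. 2, eq. (5): the printed `I₀, I₁, I₂`,
  a HyperInt computation in the source) DISCHARGED;
* `I_solvesRec_holds` — the Literature named fact `BrownZudilin2022.I_solvesRec` (Sect. 2: the third-order recursion for
  the totally symmetric integrals, the source's creative-telescoping statement) DISCHARGED.

What this is NOT: anything about the irrationality of `ζ(5)` (Brown–Zudilin's Theorem 1 concerns the GROWTH and the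
DENOMINATORS of the linear forms, untouched here); no linear form is bounded; no `γ`; records in print unmoved.
-/

noncomputable section

namespace Summit.KontsevichZagierPeriods.Zeta5Search.WedgeDictionaryClosing

open Summit.KontsevichZagierPeriods.Zeta5Search.WedgeDictionary
open Summit.KontsevichZagierPeriods.Zeta5Search.WedgeDictionarySumRuleDatum (explicitPQ_iff_oneTop explicitPQ_iff_axis QOf_aOne7
  dictPhat_aOne7 dictP_aOne7 QOf_aAxis dictPhat_aAxis dictP_aAxis)
open Summit.KontsevichZagierPeriods.Zeta5Search.WedgeDictionaryDiagonalDecomposition (I_init_iff I_solvesRec_of_I_init)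
open Summit.KontsevichZagierPeriods.Zeta5Search.WedgeDictionaryOneTop (cellularIntegral_oneTop)
open Summit.KontsevichZagierPeriods.Zeta5Search.CellularZetaFiveZero (Isym_zero)
open Literature.NumberTheory.Irrationality.BrownZudilin2022 (I_init I_solvesRec QOf cellularIntegral Isym zeta5hat)
open Literature.NumberTheory.Transcendental (zetaValue)

/-- `ExplicitPQAt` at the one-top point `(1,0,1,0,1,1,0,1)` with partner `1`: the evaluated integral equals the dictionary's
prediction `1·θ − 4·(5/4)ζ(2) − 2·(3/4)`. [folklore] -/
theorem explicitPQAt_oneTop : ExplicitPQAt ![1, 0, 1, 0, 1, 1, 0, 1] 1 := by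
  unfold ExplicitPQAt
  rw [cellularIntegral_oneTop, QOf_aOne7, dictPhat_aOne7, dictP_aOne7]
  push_cast
  ring

/-- **gen-1's wedge dictionary in its explicit `(P̂, P)` form holds** at every admissible `a` and every partner `j`
(`explicitPQ_iff_oneTop` + the one-top value). [folklore] -/
theorem explicitPQ_holds : explicitPQ := explicitPQ_iff_oneTop.2 explicitPQAt_oneTop

/-- **The wedge dictionary conjecture `wedgeDictionary` holds.** [folklore] -/
theorem wedgeDictionary_holds : wedgeDictionary := wedgeDictionary_iff_explicitPQ.2 explicitPQ_holds

/-- **Brown–Zudilin's printed initial values `I₀, I₁, I₂` (the named fact `I_init`) hold** — `I₀` by the base-value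
evaluation `Isym_zero`, `I₁, I₂` through the dictionary (`I_init_iff`). [folklore] -/
theorem I_init_holds : I_init := I_init_iff.2 ⟨Isym_zero, explicitPQ_holds⟩

/-- **Brown–Zudilin's recursion for the totally symmetric integrals (the named fact `I_solvesRec`) holds**
(`I_solvesRec_of_I_init`). [folklore] -/
theorem I_solvesRec_holds : I_solvesRec := I_solvesRec_of_I_init I_init_holds

/-- Corollary (gen-1's level-1 datum `D1`, the axis point): `I(1,0,1,0,1,1,1,1) = −(2ζ(5) + 4ζ(3)ζ(2)) + (14/3)ζ(2) + 7/3`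
(the dictionary at the axis point, `(Q, P̂, P) = (−1, −7/6, −7/6)`). [folklore] -/
theorem cellularIntegral_axis : cellularIntegral ![1, 0, 1, 0, 1, 1, 1, 1] =
    -(2 * zetaValue 5 + 4 * zetaValue 3 * zetaValue 2) + 14 / 3 * zetaValue 2 + 7 / 3 := by
  have h := explicitPQ_iff_axis.1 explicitPQ_holds
  unfold ExplicitPQAt at h
  rw [h, QOf_aAxis, dictPhat_aAxis, dictP_aAxis]
  push_cast
  ring

/-- Corollary: Brown–Zudilin's printed `I₁ = 21·I₀ − 4·(101/4)ζ(2) − 2·(87/4)` (the `n = 1` clause of `I_init`). [folklore] -/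
theorem Isym_one : Isym 1 = 21 * zeta5hat - 4 * (101 / 4 : ℝ) * zetaValue 2 - 2 * (87 / 4 : ℝ) := I_init_holds.2.1

end Summit.KontsevichZagierPeriods.Zeta5Search.WedgeDictionaryClosing
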